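import Summits.ValiantsHypothesis.ValiantsHypothesis.Theorems.FifoMatchingNNDivisionHardRowFamilies
import Summits.ValiantsHypothesis.ValiantsHypothesis.Theorems.NNDivisionHard.Negative.LocatedPencilLawFalse
import HarnessLib

/-!
# `¬ LocatedPencilLaw` BY NAME and the law chain of record (Negative lane; target `Theorems/NNDivisionHard/Negative/LocatedRowsChain.lean`)

Theorems-side port (staged by val-idea-40 g5 for the desk's hand per director-valiant R326 (3): Negative folder, namespace
`…NNDivisionHardNegative.LocatedRows`, `--kind proof --supports stmt-ValiantsHypothesis-21181`) of §6 of val-idea-40 g5's crux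
workfile `Cruxes/NNDivisionHard/LocatedRows.lean` REV 7/8 (critic of record val-idea-crit-9 g2).  Imports ONLY the shared frame
✓ p680125 `…Theorems.FifoMatchingNNDivisionHardRowFamilies` (`LocatedPencilLaw`, `ExactPencilLaw`, `pinnedRows`, `allRows`,
`CorVirtualHardN`, `exact_law_chain`) and the landed refutation ✓ p679540 `…Negative.LocatedPencilLawFalse` (crit-9 g2's N22
α-chain; director R321).

* `locatedPencilLaw_refuted : ¬ LocatedRows.LocatedPencilLaw` — by `exact` from
  `…NNDivisionHardNegative.LocatedPencil.locatedPencilLaw_false` (δ-unfolding of `entryTilted.Law`: same `RowFamily.Law` body, rows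
  `udRow a.1 + flat a.2`, rhs `1 + Σ Σ max (W i m) 0`, budget `T c n = 2 ^ ((log₂ n + c) ^ c)`);
* `exactPencilLaw_of_locatedPencilLaw` (vacuous — recorded so that nobody files it as content);
* `law_chain_of_record : ¬ LocatedPencilLaw ∧ (pinnedRows.Law → ExactPencilLaw) ∧ (ExactPencilLaw → allRows.Law) ∧
  (allRows.Law → CorVirtualHardN)`.

HONEST LABEL: `LocatedPencilLaw` (BOX rhs, C⁺_entry) is REFUTED (class refuted-misstated, witness `Q^Π_{16n}`); the law of record
C′ = `ExactPencilLaw` (exact rhs), `pinnedRows.Law`, `allRows.Law`, COR-VIRTUAL and the crux 21181 `NNDivisionHard` are OPEN and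
typed here only as `Prop`s inside implications.  VP ≠ VNP is NOT proved here or anywhere in this tree.
-/

set_option autoImplicit false

namespace Summit.ValiantsHypothesis.Theorems.NNDivisionHardNegative.LocatedRows

open Summit.ValiantsHypothesis.ValiantsHypothesis.Theorems.FifoMatching.LocatedRows
  (LocatedPencilLaw ExactPencilLaw pinnedRows allRows CorVirtualHardN exact_law_chain)

/-- ★ C⁺_entry IS DEAD, BY NAME: `¬ LocatedPencilLaw` is ✓ p679540 `locatedPencilLaw_false` by `exact` (δ-unfolding of
`entryTilted.Law`). -/
theorem locatedPencilLaw_refuted : ¬ LocatedPencilLaw :=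
  Summit.ValiantsHypothesis.Theorems.NNDivisionHardNegative.LocatedPencil.locatedPencilLaw_false

/-- The located-pencil law implies the exact law only vacuously (it is false); recorded to close the question. -/
theorem exactPencilLaw_of_locatedPencilLaw : LocatedPencilLaw → ExactPencilLaw :=
  fun h => absurd h locatedPencilLaw_refuted

/-- ★ THE CHAIN OF RECORD after N22 (one conjunction, by name): bottom rung dead, the three live implications, the top target
named. -/
theorem law_chain_of_record :
    ¬ LocatedPencilLaw ∧ (pinnedRows.Law → ExactPencilLaw) ∧ (ExactPencilLaw → allRows.Law) ∧
      (allRows.Law → CorVirtualHardN) :=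
  ⟨locatedPencilLaw_refuted, exact_law_chain⟩

end Summit.ValiantsHypothesis.Theorems.NNDivisionHardNegative.LocatedRows
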